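import Literature.MathematicalPhysics.QuantumFieldTheory.Balaban1983to89.B9Eq3133H1kPiSubH1kLetterTower
import Literature.MathematicalPhysics.QuantumFieldTheory.Balaban1983to89.B9Eq3126H1kTwoBackgroundLetterTower
import Literature.MathematicalPhysics.QuantumFieldTheory.Balaban1983to89.B9Eq3119DeltaPiTowerFlat

/-!
# `Balaban1983to89.B9Eq3133H1kPiTwoBackgroundLetterTower` — T. Bałaban, *Propagators for lattice gauge theories in a background field*, Commun. Math. Phys. **99** (1985) 389–434
# [Balaban1985BackgroundPropagators] (3.126) p. 420 *«HB = GQ*(QGQ*)⁻¹B»*, (3.122) p. 420, (3.133) p. 422, Thm 3.4 p. 400, (3.84)–(3.86) p. 407, with [Balaban1985Variational] (45)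
# p. 285: **THE TWO-BACKGROUND LADDER OF PRINT's MINIMIZER `H̃_k = G̃_kQ_k†(Q_kG̃_kQ_k†)⁻¹` (operator (3.122)) AT THE FLAT BASE, VALUE MEMBER, CONSTANTS BEFORE THE LATTICE**:
# `‖(H̃_k(U)z − H_k(1)z)(b)‖ ≤ (j₀ + α)·K·e^{−κ·d_m(Π(b₋), v)}·F`, where at the flat background print's letter IS the chain's (`B9Eq3119DeltaPiTowerFlat.H1LatticeK_laplaceAkPi_one`:
# `H̃_k(1) = H_k(1)`) — the sum of the slot difference `H̃_k(U) − H_k(U)` (gen 101's `B9Eq3133H1kPiSubH1kLetterTower`, factor `j₀` = the current window (3.36)) and the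
# chain's ladder `H_k(U) − H_k(1)` (gen 101's `B9Eq3126H1kTwoBackgroundLetterTower`, factor `α`); this is the `H`-letter of the chart actually instantiated by the cell's
# `Support/NE9CurChartTowerPi…` leaves, read against the flat chart

statement-level skeleton of published theorems with citation tags; proofs where landed; nothing here is a claim about the Yang–Mills mass gap

CITATION HEADER (lean-in-tree rule).  Audit cell `pub-balaban`, sub-cell `t4`, BINDER row NE9; filed by NE9 crux-team LEAF PROVER 01 (`b2b-balaban-t4-ne9-formalise-leaf-01`, gen 101;
ROUTE (J′), π-side; bears_on: R4/N22).  Composition BY NAME: this lineage's `B9Eq3133H1kPiSubH1kLetterTower.exists_letter_H1kPi_sub_H1k` and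
`B9Eq3126H1kTwoBackgroundLetterTower.exists_letter_H1k_sub_flat` (gen 101); ne9-leaf-03's `B9Eq3119DeltaPiTowerFlat` (cited for the consumer's rewriting `H̃_k(1) = H_k(1)`; not used in
the proof); the OWNER's `B9Eq326OperatorTower.H1k` (`H1LatticeK hpos hQ = H1k … hαL hpos` by proof irrelevance, `rfl`).  Source READ first-hand in the held text layer
`paper:balaban1985-cmp99-background-propagators` (journal page = PDF page + 388) pp. 400, 407, 419–422.  NOTHING of print's proofs is reproduced: [folklore] one triangle inequality.

WHAT IS PROVED (sorry-free; proof lane — 0 `def`; [folklore]).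
* **`exists_letter_H1kPi_sub_flat`** — `∃ α₁ j₁ > 0, K ≥ 0, κ > 0` BEFORE the UNION of (K80)'s binder block (`… hc₀η j₀ hJ hj hposπ hQ`) and the bond storey's (`hε1`, the all-direction
  window `hUw`, the flat witnesses `hpos'₁`, `hpos₁`): for every coarse-bond field `z` supported over `bpos⁻¹(v)` with `‖z(c′)‖ ≤ F` and every fine bond `b`:
  `‖(H̃_k(U)z − H_k(1)z)(b)‖ ≤ (j₀ + α)·K·e^{−κ·d_m(Π(b₋),v)}·F`, `H̃_k(U) = H1LatticeK hposπ hQ`, `H_k(1) = H1k … 1 … hpos₁` (= `H̃_k(1)` for corresponding witnesses).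
HONEST SCOPE.  Composition BY NAME on the cell's MODEL rows (O-NE9-1, #5 UNRULED); constants crude; VALUE member only (the gradient member of the slot difference needs the gradient row of
`G̃_k − G₁,k`, not in the tree); `j₀` and `α` displayed separately (their relation on print's class is lit-balaban's `B9Eq336CurrentBound`); the windows, `c₀ = η^d`, unitarity, the tower
data, `hαL`, the positivity and onto witnesses stay HYPOTHESES; nothing of [B9] (3.130)–(3.133) ∕ Thm 3.4 asserted as printed; «NE9 ⇐ the named binders»; NE9 NOT PRINTED ∕ NOT PROVED; spine
PROVED 0∕9; rung (B)+1 on a finite T⁴ — NOT infinite volume, NOT mass gap, NOT BetaPertH, NOT Clay.  HONEST DEPENDENCY: continuum YM on T⁴ ⇐ BetaPertH ∧ nine spine estimates (0/9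
proved); BetaPertH ⇐ (D1) ∧ (D4) ∧ CAP+tail; G-an2-4 gates asym, D1 and NE2/3/4.  NEW file; nothing modified.  Net new unproved facts: 0.
-/

noncomputable section

open scoped InnerProductSpace ComplexConjugate BigOperators

namespace Literature.MathematicalPhysics.QuantumFieldTheory.Balaban1983to89.B9Eq3133H1kPiTwoBackgroundLetterTower

open B4Sect5Torus (TSite tdist tdist_nonneg)
open B9SectCLatticeCarrier (Bond bpos shift unshift shift_unshift)
open B9Eq311L2Pairing (WL2)
open B9Eq319QprimeTorus (blockCoord)
open B7Prop1Explicit (U1 Wcx boxVec)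
open B11Eq103H1Complex (SiteL2K BondL2K H1LatticeK)
open B9Eq310DeltaPrime (plaqHolU)
open B9Eq310HessianOperator (adTransportW)
open B9Eq315QTorus (perCfg cornerSite)
open B9Eq315QTower (towerP UlevOf)
open B9Eq315QTowerFlat (perCfg_UlevOf_one_mem_U1 norm_Wcx_UlevOf_one_sub_one_le)
open B9Eq316TowerFlatIsOneStep (towerP_eq_fineP_pow siteCast)
open B9Eq326OperatorTower (QkW laplaceAk G1k H1k)
open B9Eq324DeltaPrimeATower (laplacePrimeAk)
open B9Eq3119DeltaPiTower (laplaceAkPi)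
open B9Eq3133H1kPiSubH1kLetterTower (exists_letter_H1kPi_sub_H1k)
open B9Eq3126H1kTwoBackgroundLetterTower (exists_letter_H1k_sub_flat)

variable {d : ℕ} (hd : 1 ≤ d) (L : ℕ) [NeZero L] (hL : 1 ≤ L) (hL3 : 3 ≤ L)
  {𝔸 : Type*} [NormedRing 𝔸] [NormedAlgebra ℂ 𝔸] [CompleteSpace 𝔸] [NormOneClass 𝔸] [StarRing 𝔸] [NormedStarGroup 𝔸] [StarModule ℂ 𝔸] [FiniteDimensional ℂ 𝔸]
  {W : Type*} [NormedAddCommGroup W] [InnerProductSpace ℂ W] [FiniteDimensional ℂ W] (φ : W ≃ₗ[ℂ] 𝔸)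
  {Mφ Mφ' : ℝ} (hMφ : 0 ≤ Mφ) (hMφ' : 0 ≤ Mφ') (hφ : ∀ w, ‖φ w‖ ≤ Mφ * ‖w‖) (hφ' : ∀ X, ‖φ.symm X‖ ≤ Mφ' * ‖X‖) (hstar : ∀ X : 𝔸, ‖star X‖ ≤ ‖X‖)
  {a : ℝ} (ha : 0 < a) {a' : ℝ} (ha' : 0 < a') {ϱ : ℝ} (hϱ0 : 0 ≤ ϱ) (hϱ1 : ϱ < 1)
  (τ : 𝔸 →ₗ[ℂ] ℂ) {Cτ : ℝ} (hτ : ∀ X, ‖τ X‖ ≤ Cτ * ‖X‖) (hCτ : 0 ≤ Cτ) {Mτ : ℝ} (hτm : ∀ X Y : 𝔸, ‖τ (X * Y)‖ ≤ Mτ * ‖X‖ * ‖Y‖) (hMτ : 0 ≤ Mτ)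
  {ρw : ℝ} (hρw : 0 ≤ ρw)
  (hτ₁ : ∀ X : 𝔸, τ (star X) = conj (τ X)) (hτ₂ : ∀ X Y : 𝔸, τ (X * Y) = τ (Y * X)) (hφτ : ∀ X Y : 𝔸, ⟪φ.symm X, φ.symm Y⟫_ℂ = τ (star X * Y))
  (AQ : ℝ)
  {ι : Type} [Fintype ι] [DecidableEq ι] (b : Module.Basis ι ℝ 𝔸) {M₂ : ℝ} (hM₂ : 0 ≤ M₂) (hrepr : ∀ (v : 𝔸) (i : ι), |b.repr v i| ≤ M₂ * ‖v‖)

include hd hL hL3 hMφ hMφ' hφ hφ' hstar ha ha' hϱ0 hϱ1 hτ hCτ hτm hMτ hρw hτ₁ hτ₂ hφτ hM₂ hrepr in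
set_option maxHeartbeats 3200000 in
set_option maxRecDepth 8192 in
/-- **THE TWO-BACKGROUND LADDER OF PRINT's `H̃_k` AT THE FLAT BASE, VALUE MEMBER** — see the module docstring. [folklore]
[cite: Balaban1985BackgroundPropagators, (3.126) p.420, (3.122) p.420, (3.133) p.422, Thm 3.4 p.400, (3.84)–(3.86) p.407; Balaban1985Variational, (45) p.285] -/
theorem exists_letter_H1kPi_sub_flat :
    ∃ α₁ j₁ K κ : ℝ, 0 < α₁ ∧ 0 < j₁ ∧ 0 ≤ K ∧ 0 < κ ∧
      ∀ (n : ℕ) (η : ℝ) (_hηL : η * (L : ℝ) ^ (n + 1) = 1) (c₀ c₁ : ℝ) [Fact (0 < c₀)] [Fact (0 < c₁)]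
        (_hw : c₀ * ((L : ℝ) ^ (n + 1)) ^ d = c₁) (_hρ : |η| ^ d / c₀ ≤ ρw) (m : Fin d → ℕ) [∀ i, NeZero (m i)] (_hm : ∀ i, 1 ≤ m i)
        (U : Bond d (towerP L m (n + 1)) → 𝔸ˣ) (αU : ℕ → ℝ) (_hα0 : ∀ j, 0 ≤ αU j) (hα1 : ∀ j, αU j ≤ 1 / 64)
        (hαL : ∀ j, 50 * (d + 1) * αU j * (L : ℝ) ^ d ≤ 1 / 2)
        (hU1 : ∀ (j : ℕ) (x : B7Prop1Explicit.Site d) (k : Fin d), perCfg (towerP L m (j + 1)) (UlevOf L m (n + 1) U j) x k ∈ U1 𝔸)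
        (hreg : ∀ (j : ℕ) (y : TSite d (towerP L m j)) (k : Fin d) (ρ' : Fin d → Fin L),
          ‖((Wcx L (perCfg (towerP L m (j + 1)) (UlevOf L m (n + 1) U j)) (cornerSite L y) k (boxVec L ρ') : 𝔸ˣ) : 𝔸) - 1‖ ≤ αU j)
        (εU : ℕ → ℝ) (_hεU : ∀ j, 0 ≤ εU j) (_hε1 : ∀ j, εU j ≤ 1) (_hUε : ∀ (j : ℕ) (b : Bond d (towerP L m (j + 1))), ‖(UlevOf L m (n + 1) U j b : 𝔸) - 1‖ ≤ εU j)
        (_hLb : ∀ (j : ℕ) (b : Bond d (towerP L m (j + 1))), UlevOf L m (n + 1) U j b ∈ U1 𝔸)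
        (α : ℝ) (_hα : 0 ≤ α) (_hαle : α ≤ α₁)
        (hUst : ∀ b, star (U b : 𝔸) = (((U b)⁻¹ : 𝔸ˣ) : 𝔸)) (_hUb : ∀ b, U b ∈ U1 𝔸) (_hUη : ∀ b, ‖(U b : 𝔸) - 1‖ ≤ α * η)
        (_hUw : ∀ (x : TSite d (towerP L m (n + 1))) (μ ν : Fin d), ‖(U (shift ν x, μ) : 𝔸) - (U (x, μ) : 𝔸)‖ ≤ α * η ^ 2)
        (_hpl : ∀ p : B9SectCLatticeCarrier.Plaq d (towerP L m (n + 1)), ‖(plaqHolU U p : 𝔸) - 1‖ ≤ α * η ^ 2)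
        (_hUgrad : ∀ (x : TSite d (towerP L m (n + 1))) (μ : Fin d), ‖(U (x, μ) : 𝔸) - U (unshift μ x, μ)‖ ≤ α * η ^ 2)
        (_hRlev : ∀ (j : ℕ) (b : Bond d (towerP L m (j + 1))) (w : W), ‖adTransportW φ (UlevOf L m (n + 1) U j) b w‖ ≤ ‖w‖)
        (_hεg : ∀ j < n + 1, εU j ≤ α * ϱ ^ j) (_hAQ : ∑ j ∈ Finset.range (n + 1), αU j ≤ AQ)
        (hpos' : ∀ x : SiteL2K ℂ d (towerP L m (n + 1)) c₀ W, x ≠ 0 → 0 < RCLike.re ⟪x, laplacePrimeAk L m n φ η U a' (c₁ := c₁) x⟫_ℂ)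
        (hpos : ∀ x : BondL2K ℂ d (towerP L m (n + 1)) c₀ W, x ≠ 0 →
          0 < RCLike.re ⟪x, laplaceAk L m n φ η U hL αU hα1 hU1 hreg τ (c₀ := c₀) (c₁ := c₁) a x⟫_ℂ)
        (_hc₀η : c₀ = η ^ d) (j₀ : ℝ) (_hJ : ∀ μ y, ‖B9Eq39Adjoint.J (fun μ => B9Eq33CovDerivVector.shiftEquiv μ) (fun μ y => U (y, μ)) η μ y‖ ≤ j₀) (_hj : j₀ ≤ j₁)
        (hposπ : ∀ x : BondL2K ℂ d (towerP L m (n + 1)) c₀ W, x ≠ 0 →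
          0 < RCLike.re ⟪x, laplaceAkPi L m n φ τ η U a' hpos' hL αU hα1 hU1 hreg (c₁ := c₁) a x⟫_ℂ)
        (hQ : Function.Surjective (QkW L m n φ U hL αU hα1 hU1 hreg (c₀ := c₀) (c₁ := c₁)))
        (hpos'₁ : ∀ x : SiteL2K ℂ d (towerP L m (n + 1)) c₀ W, x ≠ 0 →
          0 < RCLike.re ⟪x, laplacePrimeAk L m n φ η (fun _ : Bond d (towerP L m (n + 1)) => (1 : 𝔸ˣ)) a' (c₁ := c₁) x⟫_ℂ)
        (hpos₁ : ∀ x : BondL2K ℂ d (towerP L m (n + 1)) c₀ W, x ≠ 0 →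
          0 < RCLike.re ⟪x, laplaceAk L m n φ η (fun _ : Bond d (towerP L m (n + 1)) => (1 : 𝔸ˣ)) hL (fun _ => 0) (fun _ => by norm_num)
            (perCfg_UlevOf_one_mem_U1 L m (n + 1)) (norm_Wcx_UlevOf_one_sub_one_le L m (n + 1) (fun _ => 0) (fun _ => le_rfl)) τ
            (c₀ := c₀) (c₁ := c₁) a x⟫_ℂ)
        (v : TSite d m) (z : BondL2K ℂ d m c₁ W) (F : ℝ)
        (_hzv : ∀ c', bpos c' ≠ v → WL2.equiv ℂ (fun _ : Bond d m => c₁) W z c' = 0)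
        (_hzF : ∀ c', ‖WL2.equiv ℂ (fun _ : Bond d m => c₁) W z c'‖ ≤ F) (bd : Bond d (towerP L m (n + 1))),
        ‖WL2.equiv ℂ (fun _ : Bond d (towerP L m (n + 1)) => c₀) W
            (H1LatticeK hposπ hQ z -
              H1k L m n φ η (fun _ : Bond d (towerP L m (n + 1)) => (1 : 𝔸ˣ)) hL (fun _ => 0) (fun _ => by norm_num)
                (perCfg_UlevOf_one_mem_U1 L m (n + 1)) (norm_Wcx_UlevOf_one_sub_one_le L m (n + 1) (fun _ => 0) (fun _ => le_rfl)) τ (c₀ := c₀) (c₁ := c₁)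
                (fun _ => by norm_num) hpos₁ z) bd‖ ≤
          (j₀ + α) * K * Real.exp (-(κ * tdist m (blockCoord (L ^ (n + 1)) m (siteCast (towerP_eq_fineP_pow L m (n + 1)) (bpos bd))) v)) * F := by
  classical
  obtain ⟨αX, jX, KX, κX, hαX, hjX, hKX, hκX, HX⟩ :=
    exists_letter_H1kPi_sub_H1k hd L hL hL3 φ hMφ hMφ' hφ hφ' hstar ha ha' hϱ0 hϱ1 τ hτ hCτ hτm hMτ hρw hτ₁ hτ₂ hφτ AQ
  obtain ⟨αV, KV, κV, hαV, hKV, hκV, HV⟩ :=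
    exists_letter_H1k_sub_flat hd L hL hL3 φ hMφ hMφ' hφ hφ' hstar ha ha' hϱ0 hϱ1 τ hτ hCτ hτm hMτ hρw hτ₁ hτ₂ hφτ b hM₂ hrepr AQ
  set κ₀ : ℝ := min κX κV with hκ₀
  have hκ₀0 : 0 < κ₀ := lt_min hκX hκV
  have hκ₀X : κ₀ ≤ κX := min_le_left _ _
  have hκ₀V : κ₀ ≤ κV := min_le_right _ _
  refine ⟨min αX αV, jX, KX + KV, κ₀, lt_min hαX hαV, hjX, by positivity, hκ₀0, ?_⟩
  intro n η hηL c₀ c₁ _ _ hw hρ m _ hm U αU hα0 hα1 hαL hU1 hreg εU hεU hε1 hUε hLb α hα hαle hUst hUb hUη hUw hpl hUgrad hRlev hεg hAQ hpos' hpos hc₀η j₀ hJ hj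
    hposπ hQ hpos'₁ hpos₁ v z F hzv hzF bd
  have hαX' : α ≤ αX := hαle.trans (min_le_left _ _)
  have hαV' : α ≤ αV := hαle.trans (min_le_right _ _)
  haveI : Nonempty (Bond d m) := ⟨(v, ⟨0, hd⟩)⟩
  have hF : 0 ≤ F := (norm_nonneg _).trans (hzF (v, ⟨0, hd⟩))
  have hj₀ : 0 ≤ j₀ := (norm_nonneg _).trans (hJ ⟨0, hd⟩ fun _ => 0)
  -- the slot difference at `U` (factor `j₀`) and the chain's ladder (factor `α`)
  have h1 := HX n η hηL c₀ c₁ hw hρ m hm U αU hα0 hα1 hαL hU1 hreg εU hεU hUε hLb α hα hαX' hUst hUb hUη hpl hUgrad hRlev hεg hAQ hpos' hpos hc₀η j₀ hJ hj hposπ hQ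
    v z F hzv hzF bd
  have h2 := HV n η hηL c₀ c₁ hw hρ m hm U α hα hαV' hUb hUη hUw hpl hUst αU hα0 hα1 hαL hAQ hU1 hreg εU hεU hε1 hεg hUε hLb hRlev hpos' hpos hpos'₁ hpos₁
    v z F hzv hzF bd
  -- `H_k(U)` at the witness `hQ` IS `H1k … hαL hpos` (proof irrelevance)
  have e : H1LatticeK hpos hQ z = H1k L m n φ η U hL αU hα1 hU1 hreg τ (c₀ := c₀) (c₁ := c₁) hαL hpos z := rfl
  rw [← e] at h2
  set D : ℝ := tdist m (blockCoord (L ^ (n + 1)) m (siteCast (towerP_eq_fineP_pow L m (n + 1)) (bpos bd))) v with hD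
  have hD0 : 0 ≤ D := tdist_nonneg _ _ _
  have hweak : ∀ {r' : ℝ}, κ₀ ≤ r' → Real.exp (-(r' * D)) ≤ Real.exp (-(κ₀ * D)) := fun hr => Real.exp_le_exp.mpr (by nlinarith)
  have h1' := h1.trans (mul_le_mul_of_nonneg_right (mul_le_mul_of_nonneg_left (hweak hκ₀X) (mul_nonneg hj₀ hKX)) hF)
  have h2' := h2.trans (mul_le_mul_of_nonneg_right (mul_le_mul_of_nonneg_left (hweak hκ₀V) (mul_nonneg hKV hα)) hF)
  have hsplit : H1LatticeK hposπ hQ z -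
      H1k L m n φ η (fun _ : Bond d (towerP L m (n + 1)) => (1 : 𝔸ˣ)) hL (fun _ => 0) (fun _ => by norm_num)
        (perCfg_UlevOf_one_mem_U1 L m (n + 1)) (norm_Wcx_UlevOf_one_sub_one_le L m (n + 1) (fun _ => 0) (fun _ => le_rfl)) τ (c₀ := c₀) (c₁ := c₁)
        (fun _ => by norm_num) hpos₁ z =
      (H1LatticeK hposπ hQ z - H1LatticeK hpos hQ z) +
        (H1LatticeK hpos hQ z -
          H1k L m n φ η (fun _ : Bond d (towerP L m (n + 1)) => (1 : 𝔸ˣ)) hL (fun _ => 0) (fun _ => by norm_num)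
            (perCfg_UlevOf_one_mem_U1 L m (n + 1)) (norm_Wcx_UlevOf_one_sub_one_le L m (n + 1) (fun _ => 0) (fun _ => le_rfl)) τ (c₀ := c₀) (c₁ := c₁)
            (fun _ => by norm_num) hpos₁ z) := by abel
  rw [hsplit, WL2.equiv_add, Pi.add_apply]
  refine (norm_add_le _ _).trans ((add_le_add h1' h2').trans ?_)
  have hE0 : 0 ≤ Real.exp (-(κ₀ * D)) := Real.exp_nonneg _
  have hx : 0 ≤ j₀ * KV * (Real.exp (-(κ₀ * D)) * F) := by positivity
  have hy : 0 ≤ α * KX * (Real.exp (-(κ₀ * D)) * F) := by positivity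
  have hring : (j₀ + α) * (KX + KV) * Real.exp (-(κ₀ * D)) * F =
      j₀ * KX * Real.exp (-(κ₀ * D)) * F + KV * α * Real.exp (-(κ₀ * D)) * F + (j₀ * KV * (Real.exp (-(κ₀ * D)) * F) + α * KX * (Real.exp (-(κ₀ * D)) * F)) := by
    ring
  rw [hring]
  linarith

end Literature.MathematicalPhysics.QuantumFieldTheory.Balaban1983to89.B9Eq3133H1kPiTwoBackgroundLetterTower

end
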